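import Summits.CriticalPhenomena.PercolationContinuityZ3.Theorems.PercNearOneGluingNoHeavyLowerTailFrontierDecRowsTerminalEdgeInduction
import Summits.CriticalPhenomena.PercolationContinuityZ3.Theorems.PercNearOneGluingNoHeavyLowerTailFrontierDecRowsClusterMarkov
import Summits.CriticalPhenomena.PercolationContinuityZ3.Theorems.PercNearOneGluingAdditiveGluingTieLiftOne
import Literature.Probability.Percolation.KozmaNitzanSeparatingTriple
import HarnessLib

/-!
# HUB STRIPPING for Sahi's `E₃` of three group separations with a common hub:
# the edge-Bernstein decomposition at a hub edge is EXACT (no mixed terms) for pairwise-nested triples,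
# so every such row is an average of HUB-LESS rows; rows 37 and 15 of `…FrontierDecRowsLeFive` belong to ONE set-family
# ("cyclically decorated 3PT-LB") and row 37 (all `n`) follows from its hub-less members

Support file (prover seat `prim-l12-p1`, gen 4, P1 line; `--supports stmt-CriticalPhenomena-4575`).  No named facts, no sorries, no
`native_decide`, no new definitions (the group separations are the tree's `connEvent (sep X Y)` of `…E3GroupSepLeFive`, `X, Y` lists of vertices).

SETTING.  Bond percolation `prodBernoulli w` on `Fin n` with arbitrary edge weights; for vertex sets `X, Y` the decreasing event
`D[X|Y] = connEvent (sep X Y) = {no open path from X to Y}`; Sahi's functional `E₃(A,B,C) = 2μ(ABC) + μ(A)μ(B)μ(C) − Σ μ(A)μ(BC)`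
(`Literature.Probability.LatticeModels.sahiE3`).  A triple `(D[X₁|Y₁], D[X₂|Y₂], D[X₃|Y₃])` is PAIRWISE NESTED if for each pair
`i ≠ j`: `Y_i ⊆ X_j` or `Y_j ⊆ X_i`; a HUB is a vertex `t ∈ X₁ ∩ X₂ ∩ X₃`.

**Theorem 1 (`sahiE3_hubEdge`, exact Bernstein decomposition at a hub edge).**  If the triple is pairwise nested and `t` is a hub, then for
every vertex `z`, with `e = s(t,z)`, `p = w e`, `μ0 = prodBernoulli w[e ↦ 0]` and `X_i' = X_i ∪ {z}`:
  `E₃_w(D[X₁|Y₁],D[X₂|Y₂],D[X₃|Y₃]) = Σ_{S ⊆ {1,2,3}} p^{|S|} (1−p)^{3−|S|} · E₃_{μ0}(D[X_i^{(S)}|Y_i])`,  `X_i^{(S)} = X_i'` for `i ∈ S`, else `X_i`.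
That is, the two mixed Bernstein coefficients of `…FrontierDecRowsEdgeInduction.sahiE3_oneBond` are EXACTLY the averages of the singly / doubly
lifted rows — all of which are again pairwise-nested hub triples on the graph with the edge `e` removed.
PROOF.  Forcing `e` open pulls `D[X|Y]` (`t ∈ X`) back to `D[X ∪ {z}|Y]` (`preimage_insert_csep`, from `KNSep.reachable_insert_iff`), so
`μ_{w[e↦1]}(⋂ D[X_i|Y_i]) = μ0(⋂ D[X_i'|Y_i])` (`tieLiftOne_real_one_eq` of `…AdditiveGluingTieLiftOne`).  Nesting makes
the "pivotal" differences `D[X_i|Y_i] ∖ D[X_i'|Y_i]` (`= {z ~ Y_i} ∩ D[X_i|Y_i]`) pairwise DISJOINT (`lift_of_not_lift`: `z ~ Y_i ⊆ X_j` and `z ~ Y_j`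
would join `X_j` to `Y_j`), which gives nine modularity relations `μ0(E_iE_j·) + μ0(E_i'E_j'·) = μ0(E_i'E_j·) + μ0(E_iE_j'·)` (`real_modular`); modulo
these the polarised coefficients equal the lifted rows (a polynomial identity, `linear_combination`).  ∎
The consequences (hub-less members suffice; the cyclically decorated 3PT-LB family; row 37 for all `n`) are in the sequel file
`…FrontierDecRowsHubStrippingRows`.
-/

noncomputable section

namespace Summit.CriticalPhenomena.PercolationContinuityZ3.Theorems

namespace HubStripping

open MeasureTheory Literature.Probability.Percolation Literature.Probability.LatticeModels
open EdgeInduction TerminalEdgeInduction CovTransferCert E3GroupSepCert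
open scoped Classical

variable {n : ℕ}

/-! ### Group separations of vertex lists -/

/-- Membership in the group separation `D[X|Y] = connEvent (sep X Y)`: no open path from a vertex of `X` to a vertex of `Y`. [this work] -/
theorem mem_csep {X Y : List (Fin n)} {ω : BondConfig (Fin n)} :
    ω ∈ connEvent (sep X Y) ↔ ∀ p ∈ X, ∀ q ∈ Y, ¬ (openGraph ω).Reachable p q := by
  rw [connEvent_sep]
  rfl

/-- Enlarging the near side shrinks the event. [this work] -/
theorem csep_cons_subset (z : Fin n) (X Y : List (Fin n)) : connEvent (sep (z :: X) Y) ⊆ connEvent (sep X Y) :=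
  fun _ hω => mem_csep.2 fun p hp q hq => mem_csep.1 hω p (List.mem_cons_of_mem z hp) q hq

/-- A vertex on both sides makes the event empty. [this work] -/
theorem csep_eq_empty_of_mem {X Y : List (Fin n)} {t : Fin n} (hX : t ∈ X) (hY : t ∈ Y) : connEvent (sep X Y) = ∅ := by
  ext ω
  simp only [mem_csep, Set.mem_empty_iff_false, iff_false, not_forall, not_not]
  exact ⟨t, hX, t, hY, SimpleGraph.Reachable.refl t⟩

/-- **Lifting by a forced edge at a hub.**  If `t ∈ X`, forcing the pair `s(t,z)` open pulls `D[X|Y]` back to `D[z∷X|Y]`. [this work] -/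
theorem preimage_insert_csep (t z : Fin n) {X Y : List (Fin n)} (ht : t ∈ X) :
    (fun ω : BondConfig (Fin n) => insert s(t, z) ω) ⁻¹' connEvent (sep X Y) = connEvent (sep (z :: X) Y) := by
  ext ω
  simp only [Set.mem_preimage, mem_csep]
  constructor
  · intro h p hp q hq hR
    rcases List.mem_cons.1 hp with rfl | hp'
    · exact h t ht q hq ((KNSep.reachable_insert_iff ω t p t q).2 (Or.inr (Or.inl ⟨SimpleGraph.Reachable.refl t, hR⟩)))
    · exact h p hp' q hq ((KNSep.reachable_insert_iff ω t z p q).2 (Or.inl hR))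
  · intro h p hp q hq hR
    rcases (KNSep.reachable_insert_iff ω t z p q).1 hR with h1 | ⟨_, h2⟩ | ⟨_, h3⟩
    · exact h p (List.mem_cons_of_mem z hp) q hq h1
    · exact h z List.mem_cons_self q hq h2
    · exact h t (List.mem_cons_of_mem z ht) q hq h3

/-- **Nesting ⇒ no double pivot.**  If `Y₁ ⊆ X₂` or `Y₂ ⊆ X₁`, a configuration in `D[X₁|Y₁] ∖ D[z∷X₁|Y₁]` (so `z ~ Y₁`) that lies in
`D[X₂|Y₂]` also lies in `D[z∷X₂|Y₂]`. [this work] -/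
theorem lift_of_not_lift {X₁ Y₁ X₂ Y₂ : List (Fin n)} (z : Fin n) (h : Y₁ ⊆ X₂ ∨ Y₂ ⊆ X₁) {ω : BondConfig (Fin n)}
    (h1 : ω ∈ connEvent (sep X₁ Y₁)) (h1' : ω ∉ connEvent (sep (z :: X₁) Y₁)) (h2 : ω ∈ connEvent (sep X₂ Y₂)) :
    ω ∈ connEvent (sep (z :: X₂) Y₂) := by
  rw [mem_csep] at h1 h2 ⊢
  have hz : ∃ q₁ ∈ Y₁, (openGraph ω).Reachable z q₁ := by
    by_contra hc
    push Not at hc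
    refine h1' (mem_csep.2 fun p hp q hq => ?_)
    rcases List.mem_cons.1 hp with rfl | hp'
    · exact hc q hq
    · exact h1 p hp' q hq
  obtain ⟨q₁, hq₁, hz₁⟩ := hz
  intro p hp q hq hR
  rcases List.mem_cons.1 hp with rfl | hp'
  · rcases h with hY | hY
    · exact h2 q₁ (hY hq₁) q hq (hz₁.symm.trans hR)
    · exact h1 q (hY hq) q₁ hq₁ (hR.symm.trans hz₁)
  · exact h2 p hp' q hq hR

/-! ### Modularity of measures -/

/-- **Modularity.**  If `A' ⊆ A`, `B' ⊆ B` and `(A ∖ A') ∩ (B ∖ B') = ∅`, then `μ(AB·C) + μ(A'B'·C) = μ(A'B·C) + μ(AB'·C)`. [folklore] -/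
theorem real_modular (μ : Measure (BondConfig (Fin n))) [IsFiniteMeasure μ] {A A' B B' : Set (BondConfig (Fin n))}
    (hA : A' ⊆ A) (hB : B' ⊆ B) (h : ∀ ω, ω ∈ A → ω ∉ A' → ω ∈ B → ω ∈ B') (C : Set (BondConfig (Fin n))) :
    μ.real (A ∩ B ∩ C) + μ.real (A' ∩ B' ∩ C) = μ.real (A' ∩ B ∩ C) + μ.real (A ∩ B' ∩ C) := by
  have e1 : A ∩ B ∩ C = (A' ∩ B ∩ C) ∪ ((A \ A') ∩ B' ∩ C) := by
    ext ω
    simp only [Set.mem_inter_iff, Set.mem_union, Set.mem_sdiff]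
    constructor
    · rintro ⟨⟨hA1, hB1⟩, hC1⟩
      by_cases hA' : ω ∈ A'
      · exact Or.inl ⟨⟨hA', hB1⟩, hC1⟩
      · exact Or.inr ⟨⟨⟨hA1, hA'⟩, h ω hA1 hA' hB1⟩, hC1⟩
    · rintro (⟨⟨hA', hB1⟩, hC1⟩ | ⟨⟨⟨hA1, -⟩, hB'⟩, hC1⟩)
      · exact ⟨⟨hA hA', hB1⟩, hC1⟩
      · exact ⟨⟨hA1, hB hB'⟩, hC1⟩
  have e2 : A ∩ B' ∩ C = (A' ∩ B' ∩ C) ∪ ((A \ A') ∩ B' ∩ C) := by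
    ext ω
    simp only [Set.mem_inter_iff, Set.mem_union, Set.mem_sdiff]
    constructor
    · rintro ⟨⟨hA1, hB'⟩, hC1⟩
      by_cases hA' : ω ∈ A'
      · exact Or.inl ⟨⟨hA', hB'⟩, hC1⟩
      · exact Or.inr ⟨⟨⟨hA1, hA'⟩, hB'⟩, hC1⟩
    · rintro (⟨⟨hA', hB'⟩, hC1⟩ | ⟨⟨⟨hA1, -⟩, hB'⟩, hC1⟩)
      · exact ⟨⟨hA hA', hB'⟩, hC1⟩
      · exact ⟨⟨hA1, hB'⟩, hC1⟩
  have d1 : Disjoint (A' ∩ B ∩ C) ((A \ A') ∩ B' ∩ C) :=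
    Set.disjoint_left.2 fun ω h1 h2 => h2.1.1.2 h1.1.1
  have d2 : Disjoint (A' ∩ B' ∩ C) ((A \ A') ∩ B' ∩ C) :=
    Set.disjoint_left.2 fun ω h1 h2 => h2.1.1.2 h1.1.1
  rw [e1, e2, measureReal_union d1 MeasurableSet.of_discrete, measureReal_union d2 MeasurableSet.of_discrete]
  ring

/-! ### Theorem 1: the exact Bernstein decomposition at a hub edge -/

/-- **Hub edge, exact form.**  For a pairwise-nested triple of group separations with a common hub `t ∈ X₁ ∩ X₂ ∩ X₃` and any vertex `z`,
`E₃` under `prodBernoulli w` is the Bernstein combination in `p = w(s(t,z))` of the EIGHT rows obtained by adding `z` to a subset of the near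
sides, all under `prodBernoulli w[s(t,z) ↦ 0]`.  (The mixed coefficients of `EdgeInduction.sahiE3_oneBond` carry no correction terms.) [this work] -/
theorem sahiE3_hubEdge (w : Sym2 (Fin n) → unitInterval) (t z : Fin n) (X₁ Y₁ X₂ Y₂ X₃ Y₃ : List (Fin n))
    (h₁ : t ∈ X₁) (h₂ : t ∈ X₂) (h₃ : t ∈ X₃)
    (n₁₂ : Y₁ ⊆ X₂ ∨ Y₂ ⊆ X₁) (n₁₃ : Y₁ ⊆ X₃ ∨ Y₃ ⊆ X₁) (n₂₃ : Y₂ ⊆ X₃ ∨ Y₃ ⊆ X₂) :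
    sahiE3 (prodBernoulli w) (connEvent (sep X₁ Y₁)) (connEvent (sep X₂ Y₂)) (connEvent (sep X₃ Y₃)) =
      (1 - (w s(t, z) : ℝ)) ^ 3 *
          sahiE3 (prodBernoulli (Function.update w s(t, z) 0)) (connEvent (sep X₁ Y₁)) (connEvent (sep X₂ Y₂)) (connEvent (sep X₃ Y₃))
      + (w s(t, z) : ℝ) * (1 - (w s(t, z) : ℝ)) ^ 2 *
          (sahiE3 (prodBernoulli (Function.update w s(t, z) 0)) (connEvent (sep (z :: X₁) Y₁)) (connEvent (sep X₂ Y₂)) (connEvent (sep X₃ Y₃))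
            + sahiE3 (prodBernoulli (Function.update w s(t, z) 0)) (connEvent (sep X₁ Y₁)) (connEvent (sep (z :: X₂) Y₂)) (connEvent (sep X₃ Y₃))
            + sahiE3 (prodBernoulli (Function.update w s(t, z) 0)) (connEvent (sep X₁ Y₁)) (connEvent (sep X₂ Y₂)) (connEvent (sep (z :: X₃) Y₃)))
      + (w s(t, z) : ℝ) ^ 2 * (1 - (w s(t, z) : ℝ)) *
          (sahiE3 (prodBernoulli (Function.update w s(t, z) 0)) (connEvent (sep (z :: X₁) Y₁)) (connEvent (sep (z :: X₂) Y₂)) (connEvent (sep X₃ Y₃))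
            + sahiE3 (prodBernoulli (Function.update w s(t, z) 0)) (connEvent (sep (z :: X₁) Y₁)) (connEvent (sep X₂ Y₂)) (connEvent (sep (z :: X₃) Y₃))
            + sahiE3 (prodBernoulli (Function.update w s(t, z) 0)) (connEvent (sep X₁ Y₁)) (connEvent (sep (z :: X₂) Y₂)) (connEvent (sep (z :: X₃) Y₃)))
      + (w s(t, z) : ℝ) ^ 3 *
          sahiE3 (prodBernoulli (Function.update w s(t, z) 0)) (connEvent (sep (z :: X₁) Y₁)) (connEvent (sep (z :: X₂) Y₂))
            (connEvent (sep (z :: X₃) Y₃)) := by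
  rw [sahiE3_oneBond w s(t, z)]
  set p : ℝ := (w s(t, z) : ℝ) with hp
  set μ0 := prodBernoulli (Function.update w s(t, z) 0) with hμ0
  set μ1 := prodBernoulli (Function.update w s(t, z) 1) with hμ1
  set A := connEvent (sep X₁ Y₁) with hA
  set B := connEvent (sep X₂ Y₂) with hB
  set C := connEvent (sep X₃ Y₃) with hC
  set A' := connEvent (sep (z :: X₁) Y₁) with hA'
  set B' := connEvent (sep (z :: X₂) Y₂) with hB'
  set C' := connEvent (sep (z :: X₃) Y₃) with hC'
  -- the law with the pair forced open = the law with the pair closed, on the lifted events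
  have lift : ∀ S : Set (BondConfig (Fin n)), μ1.real S = μ0.real ((fun ω : BondConfig (Fin n) => insert s(t, z) ω) ⁻¹' S) :=
    fun S => tieLiftOne_real_one_eq w s(t, z) S
  have pA : (fun ω : BondConfig (Fin n) => insert s(t, z) ω) ⁻¹' A = A' := preimage_insert_csep t z h₁
  have pB : (fun ω : BondConfig (Fin n) => insert s(t, z) ω) ⁻¹' B = B' := preimage_insert_csep t z h₂
  have pC : (fun ω : BondConfig (Fin n) => insert s(t, z) ω) ⁻¹' C = C' := preimage_insert_csep t z h₃
  have rA : μ1.real A = μ0.real A' := by rw [lift, pA]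
  have rB : μ1.real B = μ0.real B' := by rw [lift, pB]
  have rC : μ1.real C = μ0.real C' := by rw [lift, pC]
  have rAB : μ1.real (A ∩ B) = μ0.real (A' ∩ B') := by rw [lift, Set.preimage_inter, pA, pB]
  have rAC : μ1.real (A ∩ C) = μ0.real (A' ∩ C') := by rw [lift, Set.preimage_inter, pA, pC]
  have rBC : μ1.real (B ∩ C) = μ0.real (B' ∩ C') := by rw [lift, Set.preimage_inter, pB, pC]
  have rABC : μ1.real (A ∩ B ∩ C) = μ0.real (A' ∩ B' ∩ C') := by
    rw [lift, Set.preimage_inter, Set.preimage_inter, pA, pB, pC]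
  -- subset and no-double-pivot facts
  have sA : A' ⊆ A := csep_cons_subset z X₁ Y₁
  have sB : B' ⊆ B := csep_cons_subset z X₂ Y₂
  have sC : C' ⊆ C := csep_cons_subset z X₃ Y₃
  have dAB : ∀ ω, ω ∈ A → ω ∉ A' → ω ∈ B → ω ∈ B' := fun ω hA1 hA2 hB1 => lift_of_not_lift z n₁₂ hA1 hA2 hB1
  have dAC : ∀ ω, ω ∈ A → ω ∉ A' → ω ∈ C → ω ∈ C' := fun ω hA1 hA2 hC1 => lift_of_not_lift z n₁₃ hA1 hA2 hC1
  have dBC : ∀ ω, ω ∈ B → ω ∉ B' → ω ∈ C → ω ∈ C' := fun ω hB1 hB2 hC1 => lift_of_not_lift z n₂₃ hB1 hB2 hC1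
  -- the nine modularity relations
  have m12 : μ0.real (A ∩ B) + μ0.real (A' ∩ B') = μ0.real (A' ∩ B) + μ0.real (A ∩ B') := by
    simpa only [Set.inter_univ] using real_modular μ0 sA sB dAB Set.univ
  have m13 : μ0.real (A ∩ C) + μ0.real (A' ∩ C') = μ0.real (A' ∩ C) + μ0.real (A ∩ C') := by
    simpa only [Set.inter_univ] using real_modular μ0 sA sC dAC Set.univ
  have m23 : μ0.real (B ∩ C) + μ0.real (B' ∩ C') = μ0.real (B' ∩ C) + μ0.real (B ∩ C') := by
    simpa only [Set.inter_univ] using real_modular μ0 sB sC dBC Set.univ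
  have m12c : μ0.real (A ∩ B ∩ C) + μ0.real (A' ∩ B' ∩ C) = μ0.real (A' ∩ B ∩ C) + μ0.real (A ∩ B' ∩ C) :=
    real_modular μ0 sA sB dAB C
  have m12c' : μ0.real (A ∩ B ∩ C') + μ0.real (A' ∩ B' ∩ C') = μ0.real (A' ∩ B ∩ C') + μ0.real (A ∩ B' ∩ C') :=
    real_modular μ0 sA sB dAB C'
  have eB : ∀ S T : Set (BondConfig (Fin n)), S ∩ T ∩ B = S ∩ B ∩ T := fun S T => Set.inter_right_comm S T B
  have eB' : ∀ S T : Set (BondConfig (Fin n)), S ∩ T ∩ B' = S ∩ B' ∩ T := fun S T => Set.inter_right_comm S T B'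
  have eA : ∀ S T : Set (BondConfig (Fin n)), S ∩ T ∩ A = A ∩ S ∩ T := fun S T => by
    rw [Set.inter_comm (S ∩ T) A, ← Set.inter_assoc]
  have eA' : ∀ S T : Set (BondConfig (Fin n)), S ∩ T ∩ A' = A' ∩ S ∩ T := fun S T => by
    rw [Set.inter_comm (S ∩ T) A', ← Set.inter_assoc]
  have m13b : μ0.real (A ∩ B ∩ C) + μ0.real (A' ∩ B ∩ C') = μ0.real (A' ∩ B ∩ C) + μ0.real (A ∩ B ∩ C') := by
    have h := real_modular μ0 sA sC dAC B
    rw [eB A C, eB A' C', eB A' C, eB A C'] at h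
    exact h
  have m13b' : μ0.real (A ∩ B' ∩ C) + μ0.real (A' ∩ B' ∩ C') = μ0.real (A' ∩ B' ∩ C) + μ0.real (A ∩ B' ∩ C') := by
    have h := real_modular μ0 sA sC dAC B'
    rw [eB' A C, eB' A' C', eB' A' C, eB' A C'] at h
    exact h
  have m23a : μ0.real (A ∩ B ∩ C) + μ0.real (A ∩ B' ∩ C') = μ0.real (A ∩ B' ∩ C) + μ0.real (A ∩ B ∩ C') := by
    have h := real_modular μ0 sB sC dBC A
    rw [eA B C, eA B' C', eA B' C, eA B C'] at h
    exact h
  have m23a' : μ0.real (A' ∩ B ∩ C) + μ0.real (A' ∩ B' ∩ C') = μ0.real (A' ∩ B' ∩ C) + μ0.real (A' ∩ B ∩ C') := by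
    have h := real_modular μ0 sB sC dBC A'
    rw [eA' B C, eA' B' C', eA' B' C, eA' B C'] at h
    exact h
  simp only [sahiE3, polar₁]
  rw [rA, rB, rC, rAB, rAC, rBC, rABC]
  linear_combination (2 * (p * (1 - p) ^ 2)) * m12c + (2 * (p * (1 - p) ^ 2)) * m13b + (2 * (p * (1 - p) ^ 2)) * m23a'
    - (p * (1 - p) ^ 2 * μ0.real A) * m23 - (p * (1 - p) ^ 2 * μ0.real B) * m13 - (p * (1 - p) ^ 2 * μ0.real C) * m12
    + (2 * (p ^ 2 * (1 - p))) * m12c' + (2 * (p ^ 2 * (1 - p))) * m13b' + (2 * (p ^ 2 * (1 - p))) * m23a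
    - (p ^ 2 * (1 - p) * μ0.real A') * m23 - (p ^ 2 * (1 - p) * μ0.real B') * m13 - (p ^ 2 * (1 - p) * μ0.real C') * m12

end HubStripping

end Summit.CriticalPhenomena.PercolationContinuityZ3.Theorems
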